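import Mathlib
import Summits.PneNP.PneNP.Theorems.OverlapGapAlgebraNoStableSectionDefs

/-!
# Route OverlapGapAlgebra, crux `NoStableSection` (stmt-PneNP-2462), line `DartGame`: stub E

Bresler–Huang, arXiv:2106.02129, Lemma 5.3, in exact counting form over the typed path space of
the crux: for FIXED rung times `ts ℓ` and FIXED assignments `Y ℓ`, the number of paths `Ψ` on which
every `Y ℓ` violates at most `J` clauses of `instAt Ψ (ts ℓ)` (the formula at time `ts ℓ`) is at
most `#{S ⊆ [m] : #S ≤ (k+1)J} · exp(-2^{-k} · D · (m - (k+1)J - (k+1))) · #PathSp`,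
`D = energySum (seqOf Y) k / n^k`.

Proof: throw out the `≤ (k+1)J` clause slots violated by some rung and the `≤ k+1` slots that are
being rewritten at one of the times `ts ℓ`; on every remaining slot `a` the clause of
`instAt Ψ (ts ℓ)` is the clause `Ψ σ a` of a fixed array `σ = src(ts ℓ, a)`, so the event is a
product set; per clause, `#{C : no rung in B falsifies C} = (2n)^k - Σ_v #{(Y ℓ ∘ v) : ℓ ∈ B}`, and
`1 - x ≤ exp(-x)` with `Σ_σ x_{B_σ} ≥ D / 2^k`.
-/

namespace Summit.PneNP.PneNP.Cruxes.NoStableSection.DartGame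

set_option linter.dupNamespace false -- `Summit.PneNP.PneNP.…`: summit = sub-problem (D-0017)

open Finset Real

/-! ## Stub E: `pathValidCount` (BH Lemma 5.3 in counting form) -/

section PathValid

variable {k m n : ℕ}

/-- The number of clauses is `(2n)^k`. -/
theorem pv_card_clause (k n : ℕ) :
    (Fintype.card (Fin k → Fin n × Bool) : ℝ) = (2 * (n : ℝ)) ^ k := by
  rw [Fintype.card_fun, Fintype.card_prod, Fintype.card_fin, Fintype.card_fin, Fintype.card_bool]
  push_cast
  ring

/-- The number of paths is `(((2n)^k)^(k+1))^m`. -/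
theorem pv_card_pathSp (k m n : ℕ) :
    (Fintype.card (PathSp k m n) : ℝ) = (((2 * (n : ℝ)) ^ k) ^ (k + 1)) ^ m := by
  rw [show (Fintype.card (PathSp k m n) : ℝ) =
      (Fintype.card (Fin (k + 1) → Fin m → Fin k → Fin n × Bool) : ℝ) from rfl,
    Fintype.card_fun, Fintype.card_fun, Fintype.card_fin, Fintype.card_fin]
  push_cast
  rw [pv_card_clause]
  ring

/-- Source index of an uninterrupted clause slot: if slot `a` is not the slot being rewritten at
time `t` (the slot `(t % (m k)) / k`), then clause `a` of `instAt Ψ t` is clause `a` of one fixed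
array `Ψ σ`, the index `σ` depending on `(t, a)` only. -/
theorem pv_instAt_const (t : ℕ) (a : Fin m) (ha : (a : ℕ) ≠ t % (m * k) / k) :
    ∃ σ : Fin (k + 1), ∀ Ψ : PathSp k m n, instAt Ψ t a = Ψ σ a := by
  by_cases ht : t < k * (m * k)
  · have hr : t / (m * k) < k := Nat.div_lt_of_lt_mul (by rwa [Nat.mul_comm] at ht)
    by_cases h1 : (a : ℕ) * k + k ≤ t % (m * k)
    · refine ⟨⟨t / (m * k) + 1, by omega⟩, fun Ψ => ?_⟩
      rw [instAt_of_lt Ψ ht ⟨t / (m * k), hr⟩ (t % (m * k)) rfl rfl]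
      funext b
      have hb : (a : ℕ) * k + b < t % (m * k) := by have := b.isLt; omega
      simp only [splice, if_pos hb]
      rfl
    · by_cases h2 : t % (m * k) ≤ (a : ℕ) * k
      · refine ⟨⟨t / (m * k), by omega⟩, fun Ψ => ?_⟩
        rw [instAt_of_lt Ψ ht ⟨t / (m * k), hr⟩ (t % (m * k)) rfl rfl]
        funext b
        have hb : ¬ (a : ℕ) * k + b < t % (m * k) := by omega
        simp only [splice, if_neg hb]
        rfl
      · exfalso
        refine ha (Nat.div_eq_of_lt_le ?_ ?_).symm
        · omega
        · rw [Nat.add_mul, Nat.one_mul]; omega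
  · exact ⟨Fin.last k, fun Ψ => by rw [instAt_of_le Ψ (Nat.not_lt.1 ht)]⟩

/-- Per-clause count: the clauses falsified by some rung `ℓ ∈ B` are counted, fibrewise over their
variable tuple `v`, by the distinct sign patterns `{(Y ℓ ∘ v) : ℓ ∈ B}` (a clause with variables `v`
is falsified by `Y ℓ` iff its signs are the negation of `Y ℓ ∘ v`). -/
theorem pv_clause_count (B : Finset (Fin (k + 1))) (Y : Fin (k + 1) → Fin n → Bool) :
    (univ.filter fun C : Fin k → Fin n × Bool => ∃ ℓ ∈ B, ∀ j, Y ℓ (C j).1 ≠ (C j).2).card =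
      ∑ v : Fin k → Fin n, (B.image fun ℓ => fun r => Y ℓ (v r)).card := by
  classical
  rw [card_eq_sum_card_fiberwise (f := fun C : Fin k → Fin n × Bool => fun r => (C r).1)
    (t := univ) fun _ _ => mem_coe.2 (mem_univ _)]
  refine sum_congr rfl fun v _ => ?_
  refine card_nbij' (fun C r => !(C r).2) (fun ξ r => (v r, !ξ r)) ?_ ?_ ?_ ?_
  · intro C hC
    rw [mem_coe, mem_filter, mem_filter] at hC
    obtain ⟨⟨-, ℓ, hℓ, hfal⟩, hv⟩ := hC
    rw [mem_coe, mem_image]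
    refine ⟨ℓ, hℓ, funext fun r => ?_⟩
    show Y ℓ (v r) = !(C r).2
    have h1 : (C r).1 = v r := by have := congrFun hv r; simpa using this
    rw [← h1]
    exact Bool.eq_not_iff.2 (hfal r)
  · intro ξ hξ
    rw [mem_coe, mem_image] at hξ
    obtain ⟨ℓ, hℓ, rfl⟩ := hξ
    rw [mem_coe, mem_filter, mem_filter]
    exact ⟨⟨mem_univ _, ℓ, hℓ, fun j => Bool.self_ne_not _⟩, rfl⟩
  · intro C hC
    rw [mem_coe, mem_filter, mem_filter] at hC
    obtain ⟨-, hv⟩ := hC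
    funext r
    simp only [Bool.not_not]
    rw [← congrFun hv r]
  · intro ξ _
    funext r
    simp only [Bool.not_not]

/-- Complement of the per-clause count: clauses falsified by no rung of `B`. -/
theorem pv_good_count (B : Finset (Fin (k + 1))) (Y : Fin (k + 1) → Fin n → Bool) :
    (univ.filter fun C : Fin k → Fin n × Bool => ∀ ℓ ∈ B, ¬ ∀ j, Y ℓ (C j).1 ≠ (C j).2).card +
        ∑ v : Fin k → Fin n, (B.image fun ℓ => fun r => Y ℓ (v r)).card =
      Fintype.card (Fin k → Fin n × Bool) := by
  rw [← pv_clause_count B Y, add_comm, ← card_univ, ← card_filter_add_card_filter_not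
    (s := (univ : Finset (Fin k → Fin n × Bool)))
    (fun C : Fin k → Fin n × Bool => ∃ ℓ ∈ B, ∀ j, Y ℓ (C j).1 ≠ (C j).2)]
  congr 2
  ext C
  simp only [mem_filter, mem_univ, true_and, not_exists, not_and]

/-- Per-slot bound: for a slot whose clause is read by rung `ℓ` from the array `τ ℓ`, the number of
`(k+1)`-tuples of clauses none of which is falsified by the rung reading it is at most
`((2n)^k)^(k+1) · exp(-2^{-k} D)`, `D = energySum / n^k` (`1 - x ≤ e^{-x}` per array, and the
pattern sets `{Y ℓ ∘ v : τ ℓ = σ}`, `σ ≤ k`, cover `{Y ℓ ∘ v : ℓ ≤ k}`). -/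
theorem pv_slot_bound (hn : 1 ≤ n) (Y : Fin (k + 1) → Fin n → Bool)
    (τ : Fin (k + 1) → Fin (k + 1)) :
    ∏ σ : Fin (k + 1), ((univ.filter fun C : Fin k → Fin n × Bool =>
        ∀ ℓ, τ ℓ = σ → ¬ ∀ j, Y ℓ (C j).1 ≠ (C j).2).card : ℝ) ≤
      ((2 * (n : ℝ)) ^ k) ^ (k + 1) *
        Real.exp (-((1 / 2 : ℝ) ^ k * ((energySum (seqOf Y) k : ℝ) / (n : ℝ) ^ k))) := by
  classical
  have hn' : (0 : ℝ) < n := by exact_mod_cast hn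
  have hNpos : (0 : ℝ) < (2 * (n : ℝ)) ^ k := pow_pos (by linarith) k
  -- each factor, exactly
  have hfac : ∀ σ : Fin (k + 1), ((univ.filter fun C : Fin k → Fin n × Bool =>
      ∀ ℓ, τ ℓ = σ → ¬ ∀ j, Y ℓ (C j).1 ≠ (C j).2).card : ℝ) =
      (2 * (n : ℝ)) ^ k - ((∑ v : Fin k → Fin n,
        ((univ.filter fun ℓ => τ ℓ = σ).image fun ℓ => fun r => Y ℓ (v r)).card : ℕ) : ℝ) := by
    intro σ
    have h1 := pv_good_count (univ.filter fun ℓ => τ ℓ = σ) Y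
    have h2 : (univ.filter fun C : Fin k → Fin n × Bool =>
        ∀ ℓ ∈ univ.filter (fun ℓ => τ ℓ = σ), ¬ ∀ j, Y ℓ (C j).1 ≠ (C j).2) =
        univ.filter fun C : Fin k → Fin n × Bool =>
          ∀ ℓ, τ ℓ = σ → ¬ ∀ j, Y ℓ (C j).1 ≠ (C j).2 := by
      refine filter_congr fun C _ => ?_
      simp only [mem_filter, mem_univ, true_and]
    rw [h2] at h1
    have h3 : (((univ.filter fun C : Fin k → Fin n × Bool =>
        ∀ ℓ, τ ℓ = σ → ¬ ∀ j, Y ℓ (C j).1 ≠ (C j).2).card : ℕ) : ℝ) +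
        ((∑ v : Fin k → Fin n, ((univ.filter fun ℓ => τ ℓ = σ).image
          fun ℓ => fun r => Y ℓ (v r)).card : ℕ) : ℝ) = (2 * (n : ℝ)) ^ k := by
      rw [← pv_card_clause k n]
      exact_mod_cast h1
    linarith
  -- each factor, bounded by `N · exp(-e/N)`
  have hbound : ∀ σ : Fin (k + 1), ((univ.filter fun C : Fin k → Fin n × Bool =>
      ∀ ℓ, τ ℓ = σ → ¬ ∀ j, Y ℓ (C j).1 ≠ (C j).2).card : ℝ) ≤
      (2 * (n : ℝ)) ^ k * Real.exp (-(((∑ v : Fin k → Fin n,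
        ((univ.filter fun ℓ => τ ℓ = σ).image fun ℓ => fun r => Y ℓ (v r)).card : ℕ) : ℝ) /
          (2 * (n : ℝ)) ^ k)) := by
    intro σ
    rw [hfac σ]
    have h := Real.add_one_le_exp (-(((∑ v : Fin k → Fin n,
        ((univ.filter fun ℓ => τ ℓ = σ).image fun ℓ => fun r => Y ℓ (v r)).card : ℕ) : ℝ) /
          (2 * (n : ℝ)) ^ k))
    have heq : (2 * (n : ℝ)) ^ k - ((∑ v : Fin k → Fin n,
        ((univ.filter fun ℓ => τ ℓ = σ).image fun ℓ => fun r => Y ℓ (v r)).card : ℕ) : ℝ) =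
        (2 * (n : ℝ)) ^ k * (-(((∑ v : Fin k → Fin n,
          ((univ.filter fun ℓ => τ ℓ = σ).image fun ℓ => fun r => Y ℓ (v r)).card : ℕ) : ℝ) /
            (2 * (n : ℝ)) ^ k) + 1) := by
      field_simp
      ring
    rw [heq]
    exact mul_le_mul_of_nonneg_left h hNpos.le
  -- the pattern sets over `σ` cover all rungs
  have hsum : energySum (seqOf Y) k ≤ ∑ σ : Fin (k + 1), ∑ v : Fin k → Fin n,
      ((univ.filter fun ℓ => τ ℓ = σ).image fun ℓ => fun r => Y ℓ (v r)).card := by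
    rw [sum_comm]
    unfold energySum
    refine sum_le_sum fun v _ => ?_
    have hpat : patternsAt (seqOf Y) k v =
        univ.image (fun ℓ : Fin (k + 1) => fun r => Y ℓ (v r)) := by
      simp only [patternsAt, seqOf_apply_fin]
    rw [hpat]
    calc (univ.image fun ℓ : Fin (k + 1) => fun r => Y ℓ (v r)).card
        ≤ (univ.biUnion fun σ : Fin (k + 1) => (univ.filter fun ℓ => τ ℓ = σ).image
            fun ℓ => fun r => Y ℓ (v r)).card := by
          refine card_le_card fun ξ hξ => ?_
          obtain ⟨ℓ, -, rfl⟩ := mem_image.1 hξ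
          exact mem_biUnion.2 ⟨τ ℓ, mem_univ _, mem_image.2 ⟨ℓ, by simp, rfl⟩⟩
      _ ≤ ∑ σ : Fin (k + 1), ((univ.filter fun ℓ => τ ℓ = σ).image
            fun ℓ => fun r => Y ℓ (v r)).card := card_biUnion_le
  have hsum' : (energySum (seqOf Y) k : ℝ) ≤ ∑ σ : Fin (k + 1), ((∑ v : Fin k → Fin n,
      ((univ.filter fun ℓ => τ ℓ = σ).image fun ℓ => fun r => Y ℓ (v r)).card : ℕ) : ℝ) := by
    exact_mod_cast hsum
  -- assemble
  calc ∏ σ : Fin (k + 1), ((univ.filter fun C : Fin k → Fin n × Bool =>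
        ∀ ℓ, τ ℓ = σ → ¬ ∀ j, Y ℓ (C j).1 ≠ (C j).2).card : ℝ)
      ≤ ∏ σ : Fin (k + 1), ((2 * (n : ℝ)) ^ k * Real.exp (-(((∑ v : Fin k → Fin n,
          ((univ.filter fun ℓ => τ ℓ = σ).image fun ℓ => fun r => Y ℓ (v r)).card : ℕ) : ℝ) /
            (2 * (n : ℝ)) ^ k))) :=
        prod_le_prod (fun σ _ => Nat.cast_nonneg _) fun σ _ => hbound σ
    _ = ((2 * (n : ℝ)) ^ k) ^ (k + 1) * Real.exp (-((∑ σ : Fin (k + 1), ((∑ v : Fin k → Fin n,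
          ((univ.filter fun ℓ => τ ℓ = σ).image fun ℓ => fun r => Y ℓ (v r)).card : ℕ) : ℝ)) /
            (2 * (n : ℝ)) ^ k)) := by
        rw [prod_mul_distrib, prod_const, card_univ, Fintype.card_fin, ← Real.exp_sum, sum_div,
          ← sum_neg_distrib]
    _ ≤ ((2 * (n : ℝ)) ^ k) ^ (k + 1) *
          Real.exp (-((1 / 2 : ℝ) ^ k * ((energySum (seqOf Y) k : ℝ) / (n : ℝ) ^ k))) := by
        refine mul_le_mul_of_nonneg_left (Real.exp_le_exp.2 (neg_le_neg ?_)) (by positivity)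
        calc (1 / 2 : ℝ) ^ k * ((energySum (seqOf Y) k : ℝ) / (n : ℝ) ^ k)
            = (energySum (seqOf Y) k : ℝ) / (2 * (n : ℝ)) ^ k := by
              rw [mul_pow, one_div_pow]
              field_simp
          _ ≤ _ := by gcongr

end PathValid

section PathValidMain

/-- **Stub E** (BH Lemma 5.3 in exact counting form): for fixed rung times `ts ℓ` and fixed
assignments `Y ℓ`, the number of paths `Ψ` on which every `Y ℓ` violates at most `J` clauses of
`instAt Ψ (ts ℓ)` is at most
`#{S ⊆ [m] : #S ≤ (k+1)J} · exp(-2^{-k} · (energySum (seqOf Y) k / n^k) · (m - (k+1)J - (k+1)))`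
times `#PathSp`. -/
theorem stub_pathValidCount :
  ∀ (k m n : ℕ) (ts : Fin (k + 1) → ℕ) (Y : Fin (k + 1) → Fin n → Bool) (J : ℕ),
    1 ≤ n → (∀ ℓ, ts ℓ ≤ k * (m * k)) →
    ((Finset.univ.filter fun Ψ : PathSp k m n =>
        ∀ ℓ, violCount (Y ℓ) (instAt Ψ (ts ℓ)) ≤ J).card : ℝ) ≤
      (∑ j ∈ Finset.range ((k + 1) * J + 1), (m.choose j : ℝ)) *
        Real.exp (-((1 / 2 : ℝ) ^ k * ((energySum (seqOf Y) k : ℝ) / (n : ℝ) ^ k) *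
          ((m : ℝ) - (k + 1) * J - (k + 1)))) *
        Fintype.card (PathSp k m n) := by
  intro k m n ts Y J hn _hts
  classical
  -- source arrays of the uninterrupted slots
  have hsrc' : ∀ (t : ℕ) (a : Fin m), ∃ σ : Fin (k + 1), (a : ℕ) ≠ t % (m * k) / k →
      ∀ Ψ : PathSp k m n, instAt Ψ t a = Ψ σ a := fun t a => by
    by_cases h : (a : ℕ) ≠ t % (m * k) / k
    · obtain ⟨σ, hσ⟩ := pv_instAt_const (n := n) t a h
      exact ⟨σ, fun _ => hσ⟩
    · exact ⟨0, fun h' => absurd h' h⟩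
  choose src hsrc using hsrc'
  -- abbreviations
  set c : ℝ := (1 / 2 : ℝ) ^ k * ((energySum (seqOf Y) k : ℝ) / (n : ℝ) ^ k) with hc
  have hc0 : 0 ≤ c := by rw [hc]; positivity
  set K : ℕ := (k + 1) * J with hK
  -- the interrupted slots
  set U : Finset (Fin m) := univ.filter fun a : Fin m => ∃ ℓ, (a : ℕ) = ts ℓ % (m * k) / k with hU
  have hUcard : U.card ≤ k + 1 := by
    calc U.card ≤ (univ.image fun ℓ : Fin (k + 1) => ts ℓ % (m * k) / k).card := by
          refine card_le_card_of_injOn (fun a : Fin m => (a : ℕ)) (fun a ha => ?_)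
            (fun a _ b _ h => Fin.ext h)
          simp only [hU, coe_filter, mem_univ, true_and, Set.mem_setOf_eq] at ha
          obtain ⟨ℓ, hℓ⟩ := ha
          rw [mem_coe, mem_image]
          exact ⟨ℓ, mem_univ _, hℓ.symm⟩
      _ ≤ (univ : Finset (Fin (k + 1))).card := card_image_le
      _ = k + 1 := by simp
  -- the sets of violated slots and the product events
  set 𝒮 : Finset (Finset (Fin m)) :=
    (univ : Finset (Fin m)).powerset.filter fun S => S.card ≤ K with h𝒮
  set G : Finset (Fin m) → Finset (PathSp k m n) := fun S =>
    Fintype.piFinset fun σ : Fin (k + 1) => Fintype.piFinset fun a : Fin m =>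
      univ.filter fun C : Fin k → Fin n × Bool =>
        a ∉ S → a ∉ U → ∀ ℓ, src (ts ℓ) a = σ → ¬ ∀ j, Y ℓ (C j).1 ≠ (C j).2 with hG
  -- Step 1: the event is covered by the product events
  have hcover : (univ.filter fun Ψ : PathSp k m n =>
      ∀ ℓ, violCount (Y ℓ) (instAt Ψ (ts ℓ)) ≤ J) ⊆ 𝒮.biUnion G := by
    intro Ψ hΨ
    rw [mem_filter] at hΨ
    obtain ⟨-, hΨ⟩ := hΨ
    rw [mem_biUnion]
    refine ⟨univ.filter fun a : Fin m =>
      ∃ ℓ, ∀ j, Y ℓ (instAt Ψ (ts ℓ) a j).1 ≠ (instAt Ψ (ts ℓ) a j).2, ?_, ?_⟩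
    · rw [h𝒮, mem_filter, mem_powerset]
      refine ⟨subset_univ _, ?_⟩
      calc (univ.filter fun a : Fin m =>
              ∃ ℓ, ∀ j, Y ℓ (instAt Ψ (ts ℓ) a j).1 ≠ (instAt Ψ (ts ℓ) a j).2).card
          ≤ (univ.biUnion fun ℓ : Fin (k + 1) => univ.filter fun a : Fin m =>
              ∀ j, Y ℓ (instAt Ψ (ts ℓ) a j).1 ≠ (instAt Ψ (ts ℓ) a j).2).card := by
            refine card_le_card fun a ha => ?_
            obtain ⟨ℓ, hℓ⟩ := (mem_filter.1 ha).2
            exact mem_biUnion.2 ⟨ℓ, mem_univ _, mem_filter.2 ⟨mem_univ _, hℓ⟩⟩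
        _ ≤ ∑ ℓ : Fin (k + 1), (univ.filter fun a : Fin m =>
              ∀ j, Y ℓ (instAt Ψ (ts ℓ) a j).1 ≠ (instAt Ψ (ts ℓ) a j).2).card := card_biUnion_le
        _ ≤ ∑ _ℓ : Fin (k + 1), J := sum_le_sum fun ℓ _ => hΨ ℓ
        _ = K := by simp [hK]
    · simp only [hG, Fintype.mem_piFinset, mem_filter, mem_univ, true_and]
      intro σ a haS haU ℓ hℓσ hfal
      have haU' : (a : ℕ) ≠ ts ℓ % (m * k) / k := fun h =>
        haU (by rw [hU]; exact mem_filter.2 ⟨mem_univ _, ℓ, h⟩)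
      have key := hsrc (ts ℓ) a haU' Ψ
      rw [hℓσ] at key
      exact haS ⟨ℓ, fun j => by rw [key]; exact hfal j⟩
  -- Step 2: the number of sets of violated slots
  have h𝒮card : (𝒮.card : ℝ) ≤ ∑ j ∈ range (K + 1), (m.choose j : ℝ) := by
    have hsub : 𝒮 ⊆ (range (K + 1)).biUnion fun j => powersetCard j (univ : Finset (Fin m)) := by
      intro S hS
      rw [h𝒮, mem_filter] at hS
      exact mem_biUnion.2 ⟨S.card, mem_range.2 (Nat.lt_succ_of_le hS.2),
        mem_powersetCard.2 ⟨subset_univ _, rfl⟩⟩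
    calc (𝒮.card : ℝ)
        ≤ (((range (K + 1)).biUnion fun j => powersetCard j (univ : Finset (Fin m))).card : ℝ) := by
          exact_mod_cast card_le_card hsub
      _ ≤ ∑ j ∈ range (K + 1), ((powersetCard j (univ : Finset (Fin m))).card : ℝ) := by
          exact_mod_cast card_biUnion_le
      _ = ∑ j ∈ range (K + 1), (m.choose j : ℝ) := by simp [card_powersetCard]
  -- Step 3: each product event is small
  have hGcard : ∀ S : Finset (Fin m), ((G S).card : ℝ) ≤
      (((2 * (n : ℝ)) ^ k) ^ (k + 1)) ^ m * Real.exp (-c) ^ ((S ∪ U)ᶜ.card) := by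
    intro S
    have hslot : ∀ a : Fin m, (∏ σ : Fin (k + 1), ((univ.filter fun C : Fin k → Fin n × Bool =>
        a ∉ S → a ∉ U → ∀ ℓ, src (ts ℓ) a = σ → ¬ ∀ j, Y ℓ (C j).1 ≠ (C j).2).card : ℝ)) ≤
        ((2 * (n : ℝ)) ^ k) ^ (k + 1) * if a ∈ (S ∪ U)ᶜ then Real.exp (-c) else 1 := by
      intro a
      by_cases ha : a ∈ (S ∪ U)ᶜ
      · rw [if_pos ha]
        rw [mem_compl, notMem_union] at ha
        have hfc : ∀ σ : Fin (k + 1), (univ.filter fun C : Fin k → Fin n × Bool =>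
            a ∉ S → a ∉ U → ∀ ℓ, src (ts ℓ) a = σ → ¬ ∀ j, Y ℓ (C j).1 ≠ (C j).2) =
            univ.filter fun C : Fin k → Fin n × Bool =>
              ∀ ℓ, src (ts ℓ) a = σ → ¬ ∀ j, Y ℓ (C j).1 ≠ (C j).2 :=
          fun σ => filter_congr fun C _ => ⟨fun h => h ha.1 ha.2, fun h _ _ => h⟩
        simp only [hfc]
        exact pv_slot_bound hn Y fun ℓ => src (ts ℓ) a
      · rw [if_neg ha, mul_one]
        rw [mem_compl, not_not] at ha
        have hfc : ∀ σ : Fin (k + 1), (univ.filter fun C : Fin k → Fin n × Bool =>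
            a ∉ S → a ∉ U → ∀ ℓ, src (ts ℓ) a = σ → ¬ ∀ j, Y ℓ (C j).1 ≠ (C j).2) = univ :=
          fun σ => filter_true_of_mem fun C _ haS haU => absurd ha (notMem_union.2 ⟨haS, haU⟩)
        simp only [hfc, card_univ, prod_const, Fintype.card_fin]
        rw [pv_card_clause]
    calc ((G S).card : ℝ)
        = ∏ σ : Fin (k + 1), ∏ a : Fin m, ((univ.filter fun C : Fin k → Fin n × Bool =>
            a ∉ S → a ∉ U → ∀ ℓ, src (ts ℓ) a = σ → ¬ ∀ j, Y ℓ (C j).1 ≠ (C j).2).card : ℝ) := by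
          simp only [hG, Fintype.card_piFinset, Nat.cast_prod]
      _ = ∏ a : Fin m, ∏ σ : Fin (k + 1), ((univ.filter fun C : Fin k → Fin n × Bool =>
            a ∉ S → a ∉ U → ∀ ℓ, src (ts ℓ) a = σ → ¬ ∀ j, Y ℓ (C j).1 ≠ (C j).2).card : ℝ) :=
          prod_comm
      _ ≤ ∏ a : Fin m, (((2 * (n : ℝ)) ^ k) ^ (k + 1) *
            if a ∈ (S ∪ U)ᶜ then Real.exp (-c) else 1) :=
          prod_le_prod (fun a _ => prod_nonneg fun σ _ => Nat.cast_nonneg _) fun a _ => hslot a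
      _ = (((2 * (n : ℝ)) ^ k) ^ (k + 1)) ^ m * Real.exp (-c) ^ ((S ∪ U)ᶜ.card) := by
          rw [prod_mul_distrib, prod_const, card_univ, Fintype.card_fin, prod_ite_mem, univ_inter,
            prod_const]
  -- Step 4: the number of good slots
  have hexp : ∀ S ∈ 𝒮, Real.exp (-c) ^ ((S ∪ U)ᶜ.card) ≤
      Real.exp (-(c * ((m : ℝ) - (k + 1) * J - (k + 1)))) := by
    intro S hS
    rw [h𝒮, mem_filter] at hS
    have h2 : (S ∪ U)ᶜ.card = m - (S ∪ U).card := by rw [card_compl, Fintype.card_fin]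
    have h3 : (S ∪ U).card ≤ K + (k + 1) := (card_union_le _ _).trans (add_le_add hS.2 hUcard)
    have h4 : (S ∪ U).card ≤ m := by simpa using card_le_univ (S ∪ U)
    have h5 : (((S ∪ U)ᶜ.card : ℕ) : ℝ) = m - (S ∪ U).card := by rw [h2, Nat.cast_sub h4]
    have h6 : (((S ∪ U).card : ℕ) : ℝ) ≤ K + (k + 1) := by exact_mod_cast h3
    have h1 : (m : ℝ) - (k + 1) * J - (k + 1) ≤ (((S ∪ U)ᶜ.card : ℕ) : ℝ) := by
      rw [h5]
      simp only [hK, Nat.cast_mul, Nat.cast_add, Nat.cast_one] at h6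
      linarith
    rw [← Real.exp_nat_mul, Real.exp_le_exp]
    have := mul_le_mul_of_nonneg_left h1 hc0
    linarith
  -- assemble
  have hpos : (0 : ℝ) ≤ (((2 * (n : ℝ)) ^ k) ^ (k + 1)) ^ m := by positivity
  calc _ ≤ ((𝒮.biUnion G).card : ℝ) := by exact_mod_cast card_le_card hcover
    _ ≤ ∑ S ∈ 𝒮, ((G S).card : ℝ) := by exact_mod_cast card_biUnion_le
    _ ≤ ∑ S ∈ 𝒮, (((2 * (n : ℝ)) ^ k) ^ (k + 1)) ^ m *
          Real.exp (-(c * ((m : ℝ) - (k + 1) * J - (k + 1)))) :=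
        sum_le_sum fun S hS => (hGcard S).trans (mul_le_mul_of_nonneg_left (hexp S hS) hpos)
    _ = 𝒮.card * ((((2 * (n : ℝ)) ^ k) ^ (k + 1)) ^ m *
          Real.exp (-(c * ((m : ℝ) - (k + 1) * J - (k + 1))))) := by
        rw [sum_const, nsmul_eq_mul]
    _ ≤ (∑ j ∈ range (K + 1), (m.choose j : ℝ)) * ((((2 * (n : ℝ)) ^ k) ^ (k + 1)) ^ m *
          Real.exp (-(c * ((m : ℝ) - (k + 1) * J - (k + 1))))) :=
        mul_le_mul_of_nonneg_right h𝒮card (by positivity)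
    _ = _ := by rw [pv_card_pathSp]; ring

end PathValidMain

end Summit.PneNP.PneNP.Cruxes.NoStableSection.DartGame
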